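/-
Copyright (c) 2026 the pub-hodgecm-mathlib formalisation cell (harness21).  Prover seat hodgecm-mathlib-K2E1-p04 (g0), Track B ∕ K2-LIT
(build stream 29), h413 = `stmt-HodgeConjecture-24833`, line `K2_E1_TraceFormulaBeta`, socket module «GlobalIndex» §1, file #4 — the payment of
`K2E1TraceFormulaBeta.GlobalIndex.sig_K2E1OccursEventuallySpherical` TOKEN FOR TOKEN.  2026-09-03.
-/
import Summits.HodgeConjecture.HodgeConjecture.Theorems.F0P3GlobalPacketDiscrete      -- ★ `cmOccursInDiscreteSpectrum` (+ `_iff`); cone: ★ `F0P3FinComponentTokens.isotypicComponent_eq_top_of_isConstituentOf`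
import Literature.NumberTheory.Automorphic.UnitaryGroupLocalTypeSpherical            -- ★ `UnitaryGroup.isSpherical_localType_cofinite'` (the dimension count, Flath Thm. 2)
import Literature.NumberTheory.Automorphic.IrreducibleClassesComapSpherical          -- ★ `IrrClass.isSpherical_comap_iff_of_forall_mem_iff`
import Literature.NumberTheory.Automorphic.LocalUnitaryIntegralLevel                 -- ★ `cmLocalIntegralLevel`, `isCompact_isOpen_cmLocalIntegralLevel`, `localPiEquiv_mem_localIntegralLevel_iff`
import HarnessLib

/-!
# h413 ∕ Track B «K2-LIT», line `K2_E1_TraceFormulaBeta`, socket module «GlobalIndex» §1: AN OCCURRING FAMILY OF FINITE LOCAL CLASSES IS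
# SPHERICAL AT ALL BUT FINITELY MANY PLACES
# (payment of `Cruxes/H413/Lines/K2_E1_TraceFormulaBetaSigs_GlobalIndex.lean :: sig_K2E1OccursEventuallySpherical`, statement bytes frozen)

Cell `pub/hodgecm-mathlib`, crux H413 = `stmt-HodgeConjecture-24833`, route of record `HCCMUnconditional`; chair K2-lead (g0), dealer K2E1-plan (g0),
EMIT «SKELETON LANDED K2E1» (REQUESTS l.72374) file #4 `sig_K2E1OccursEventuallySpherical` (L) ↦ seat K2E1-p04.
THEOREMS ONLY (no `def`, no `instance`, no `notation`, no named-fact hypothesis, no `sorry`); imports = ★ Theorems ∕ ★ Literature + HarnessLib;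
lane `--supports stmt-HodgeConjecture-24833 --as helper` (count-neutral).

THE STATEMENT (bytes of the socket; the organ abbreviation `Pl L := HeightOneSpectrum (𝓞 L⁺)` of `Cruxes/H413/Lines/F0_P3c_StCharTSPaydown.lean`
is spelled out, `Theorems/` never importing `Cruxes/…/Lines/…`).  For a CM field `L`, ANY `N` and ANY `H ∈ M_N(L)` (no hermitian ∕ invertibility
hypothesis), any automorphic measure `μ` on `U(H)(L⁺)\U(H)(𝔸_{L⁺})`, and any family `π = (π_u)_u` of classes of the local groups
`U(H)(L⁺_u) = (cmDatum L N H).Local u` that OCCURS IN THE DISCRETE SPECTRUM (★ `cmOccursInDiscreteSpectrum`: some discrete automorphic `P` has an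
irreducible smooth admissible finite component `σ` of `U(H)(𝔸_{L⁺,f})` whose constituent class at every finite place `u` is exactly `π_u`, read
through ★ `localPiEquiv u`): for all but finitely many `u` there is a compact open `K ≤ U(H)(L⁺_u)` with `π_u` `K`-SPHERICAL (★ `IrrClass.IsSpherical`:
a LINE of `K`-fixed vectors).  The witness is the integral level `K = U(H)(𝒪_u)` (★ `cmLocalIntegralLevel L N H u`).

THE PROOF (strategy: FLATH'S DIMENSION COUNT through admissibility of the GLOBAL `σ` — no Gelfand pair, no Satake, no reductivity of `U(H)`, hence valid
for every matrix `H`; [FlathCorvallis1979, Thm. 2 and §2 Example 2]; [Bump1997, §3.4 Prop. 3.4.2]).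
(1) Unfold the CM currency (★ `cmOccursInDiscreteSpectrum_iff`): `σ` irreducible, smooth, admissible on `W ≠ 0`, and at every finite place `v` of `L⁺`
    the pulled-back class `π′_v := IrrClass.comap (localPiEquiv v) (π v)` of `U(H)(L⁺_v) = localPi v` IS a constituent of `σ ∘ inclPlace v`.
(2) A representative `r_v` of `π′_v` is a LOCAL TYPE of `σ` at `v`: `σ ∘ inclPlace v` is `r_v`-isotypic (★ `F0P3FinComponentTokens.isotypicComponent_eq_top_of_isConstituentOf`,
    Flath's purification ★ `F0P2cStubCLLocalTypeExists.stubCL_holds` + Mathlib `isotypicComponent`).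
(3) THE COUNT ★ `UnitaryGroup.isSpherical_localType_cofinite'`: the local types of an admissible representation on a non-zero space are `U(H)(𝒪_v)`-spherical
    (`dim r_v^{U(H)(𝒪_v)} = 1`) for all but finitely many `v` — a box `∏ L_v` fixing a non-zero vector has finite-dimensional fixed space of dimension
    divisible by `∏ dim r_v^{L_v}` over any finite set of places.
(4) Transport back to the matrix carrier `(cmDatum L N H).Local v` along the level-matching ★ `localPiEquiv v` (★ `localPiEquiv_mem_localIntegralLevel_iff`,
    ★ `IrrClass.isSpherical_comap_iff_of_forall_mem_iff`); `U(H)(𝒪_v)` is compact open (★ `isCompact_isOpen_cmLocalIntegralLevel`).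

* §1 `isSpherical_comap_localPiEquiv_cofinite` — steps (1)–(3) in the `localPi ∕ localInt` currency (generic in the occurring family);
* §2 **`OccursEventuallySpherical`**   — `sig_K2E1OccursEventuallySpherical` TOKEN FOR TOKEN (tie probe
      `example : type_of% @OccursEventuallySpherical = type_of% @K2E1TraceFormulaBeta.GlobalIndex.sig_K2E1OccursEventuallySpherical := rfl`
      at home once the socket module is built on stream 29: `K2/K2E1-p04/g0/Probe_K2E1OccursEventuallySpherical.lean`).

WHAT IS NOT HERE.  The archimedean component; unramifiedness in the sense of `L`-parameters («π_u = ξ_H(ρ_u) unramified», [Rogawski1990 §13.8 p. 219]) —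
this file gives the `K_u = U(H)(𝒪_u)`-spherical LINE at almost every `u`, which is what makes `f^∞ = Π f_u` with units almost everywhere meaningful.

HONEST LABEL.  HC_CM is proved only modulo the 7 printed citations (2 remaining named inputs: hLiu418 = `stmt-HodgeConjecture-24832`, h413 =
`stmt-HodgeConjecture-24833`) until rung 0 closes; this file moves no counter.

## References
* [FlathCorvallis1979] D. Flath, *Decomposition of representations into tensor products*, PSPM 33.1 (1979), Thm. 2, Thm. 3, §2 Example 2.
* [BorelJacquet1979] A. Borel, H. Jacquet, *Automorphic forms and automorphic representations*, PSPM 33.1 (1979), §4.6.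
* [Bump1997] D. Bump, *Automorphic Forms and Representations* (1997), §3.4 Prop. 3.4.2.
* [Rogawski1990] J. Rogawski, *Automorphic representations of unitary groups in three variables*, Ann. of Math. Stud. 123 (1990), §13.8 p. 219
  («π_u unramified for finite u ≠ w»; context only).
-/

set_option autoImplicit false
-- the mandated namespace repeats the single-problem summit's segment (`HodgeConjecture.HodgeConjecture`)
set_option linter.dupNamespace false

noncomputable section

open NumberField IsDedekindDomain MeasureTheory Filter
open Literature.NumberTheory.Automorphic Literature.NumberTheory.Automorphic.UnitaryGroup
open Summit.HodgeConjecture.HodgeConjecture.Cruxes.H413.F0P3GlobalPacketDiscrete (cmOccursInDiscreteSpectrum cmOccursInDiscreteSpectrum_iff)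
open Summit.HodgeConjecture.HodgeConjecture.Cruxes.H413.F0P3FinComponentTokens (isotypicComponent_eq_top_of_isConstituentOf)

namespace Summit.HodgeConjecture.HodgeConjecture.Cruxes.H413.K2E1OccursEventuallySpherical

/-! ## §1 The dimension count, read on an occurring family (factor carrier `localPi ∕ localInt`) -/

/-- **An occurring family is `U(H)(𝒪_v)`-spherical at almost every place, on the factor carrier.**  If `π = (π_v)_v` occurs in the discrete spectrum
(★ `cmOccursInDiscreteSpectrum L N H μ π`), then for all but finitely many finite places `v` of `L⁺` the pulled-back class
`IrrClass.comap (localPiEquiv v) (π v)` of `U(H)(L⁺_v) = localPi v` has a LINE of `localInt v`-fixed vectors.  Proof: representatives are local types of the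
irreducible admissible finite component `σ` (★ `isotypicComponent_eq_top_of_isConstituentOf`), and the local types of an admissible representation on a
non-zero space are spherical almost everywhere (★ `UnitaryGroup.isSpherical_localType_cofinite'`, Flath's count).
[cite: FlathCorvallis1979, Thm. 2 and §2 Example 2] [cite: Bump1997, §3.4 Prop. 3.4.2] [cite: BorelJacquet1979, §4.6] -/
theorem isSpherical_comap_localPiEquiv_cofinite (L : Type) [Field L] [NumberField L] [IsCMField L] (N : ℕ) (H : Matrix (Fin N) (Fin N) L)
    (μ : Measure (adelicGroupData (↥(maximalRealSubfield L)) L (IsCMField.complexConj L) N H).automorphicQuotient)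
    [(adelicGroupData (↥(maximalRealSubfield L)) L (IsCMField.complexConj L) N H).IsAutomorphicMeasure μ]
    (π : ∀ u : HeightOneSpectrum (𝓞 ↥(maximalRealSubfield L)), IrrClass ((UnitaryGroup.cmDatum L N H).Local u))
    (hπ : cmOccursInDiscreteSpectrum L N H μ π) :
    ∀ᶠ u in Filter.cofinite,
      (IrrClass.comap (localPiEquiv L (IsCMField.complexConj L) N H u) (π u)).IsSpherical (localInt L (IsCMField.complexConj L) N H u) := by
  -- (1) the CM currency unfolded: the irreducible admissible finite component `σ` and the constituent clause
  obtain ⟨_P, W, _, _, σ, hirr, _hsm, hadm, _hP, hiff⟩ := (cmOccursInDiscreteSpectrum_iff L N H μ π).1 hπ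
  -- (2) representatives of the pulled-back classes; they are constituents, hence local types
  have hrep : ∀ u : HeightOneSpectrum (𝓞 ↥(maximalRealSubfield L)),
      ∃ r : SmoothIrrep (localPi L (IsCMField.complexConj L) N H u),
        IrrClass.mk r = IrrClass.comap (localPiEquiv L (IsCMField.complexConj L) N H u) (π u) :=
    fun u => IrrClass.mk_surjective _
  choose r hr using hrep
  have hconst : ∀ u : HeightOneSpectrum (𝓞 ↥(maximalRealSubfield L)),
      (IrrClass.mk (r u)).IsConstituentOf (σ.comp (inclPlace (↥(maximalRealSubfield L)) L (IsCMField.complexConj L) N H u)) :=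
    fun u => (hiff u (IrrClass.mk (r u))).2 (hr u)
  have hiso : ∀ u : HeightOneSpectrum (𝓞 ↥(maximalRealSubfield L)),
      isotypicComponent (MonoidAlgebra ℂ (localPi L (IsCMField.complexConj L) N H u))
        (Representation.asModule (σ.comp (inclPlace (↥(maximalRealSubfield L)) L (IsCMField.complexConj L) N H u)))
        (Representation.asModule (r u).ρ) = ⊤ :=
    fun u => isotypicComponent_eq_top_of_isConstituentOf hirr hadm u (r u) (hconst u)
  -- (3) the dimension count
  haveI : Nontrivial W := IrrClass.nontrivial_of_isIrreducible σ
  have hsph : ∀ᶠ u in Filter.cofinite, (r u).ρ.IsSpherical (localInt L (IsCMField.complexConj L) N H u) :=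
    isSpherical_localType_cofinite' (↥(maximalRealSubfield L)) L (IsCMField.complexConj L) N H σ hadm (fun u => (r u).ρ)
      (fun u => (r u).isIrreducible) hiso
  filter_upwards [hsph] with u hu
  rw [← hr u, IrrClass.isSpherical_mk]
  exact hu

/-! ## §2 The socket `sig_K2E1OccursEventuallySpherical`, token for token -/

/-- **Socket #4 `sig_K2E1OccursEventuallySpherical` of `Cruxes/H413/Lines/K2_E1_TraceFormulaBetaSigs_GlobalIndex.lean` (statement bytes frozen; the organ
abbreviation `Pl L = HeightOneSpectrum (𝓞 L⁺)` spelled out).**  An OCCURRING family of finite local classes of `U(H)` (any CM field `L`, any `N`, ANY matrix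
`H`) is SPHERICAL — a line of fixed vectors, ★ `IrrClass.IsSpherical` — for some compact open subgroup at ALL BUT FINITELY MANY places; the witness is the
integral level `U(H)(𝒪_u)` (★ `cmLocalIntegralLevel`, compact open ★ `isCompact_isOpen_cmLocalIntegralLevel`), §1 moved to the matrix carrier along the
level-matching ★ `localPiEquiv u` (★ `localPiEquiv_mem_localIntegralLevel_iff`, ★ `IrrClass.isSpherical_comap_iff_of_forall_mem_iff`).  Print: the finite
component of a discrete automorphic representation is `⊗′ σ_u` with `σ_u` class one for almost all `u`.
[cite: FlathCorvallis1979, Thm. 3] [cite: BorelJacquet1979, §4.6] [cite: Rogawski1990, §13.8 p. 219] -/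
theorem OccursEventuallySpherical :
    ∀ (L : Type) [Field L] [NumberField L] [IsCMField L] (N : ℕ) (H : Matrix (Fin N) (Fin N) L)
      (μ : Measure (adelicGroupData (↥(maximalRealSubfield L)) L (IsCMField.complexConj L) N H).automorphicQuotient)
      [(adelicGroupData (↥(maximalRealSubfield L)) L (IsCMField.complexConj L) N H).IsAutomorphicMeasure μ]
      (π : ∀ u : HeightOneSpectrum (𝓞 ↥(maximalRealSubfield L)), IrrClass ((UnitaryGroup.cmDatum L N H).Local u)),
      cmOccursInDiscreteSpectrum L N H μ π →
        ∀ᶠ u in Filter.cofinite, ∃ K : Subgroup ((UnitaryGroup.cmDatum L N H).Local u),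
          IsOpen (K : Set ((UnitaryGroup.cmDatum L N H).Local u)) ∧ IsCompact (K : Set ((UnitaryGroup.cmDatum L N H).Local u)) ∧ (π u).IsSpherical K := by
  intro L _ _ _ N H μ _ π hπ
  filter_upwards [isSpherical_comap_localPiEquiv_cofinite L N H μ π hπ] with u hu
  refine ⟨cmLocalIntegralLevel L N H u, (isCompact_isOpen_cmLocalIntegralLevel L N H u).2, (isCompact_isOpen_cmLocalIntegralLevel L N H u).1, ?_⟩
  exact (IrrClass.isSpherical_comap_iff_of_forall_mem_iff (localPiEquiv L (IsCMField.complexConj L) N H u) (π u)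
    (localPiEquiv_mem_localIntegralLevel_iff (IsCMField.complexConj L) N H u)).1 hu

/-! ## §3 The socket in its ED. 3 bytes (hermitian, non-degenerate `H`), token for token — APPEND 1

The dealer's self-audit edition ED. 3 of `Cruxes/H413/Lines/K2_E1_TraceFormulaBetaSigs_GlobalIndex.lean` (commit 00be29604e6d, sha16 22a272caabdb2f3e,
2026-09-03T21:04Z) re-cut socket #4 with the two extra binders `(H.map (cmConjRingHom L))ᵀ = H → H.det ≠ 0 →` («reductive `U(H)`: Flath + admissibility»).
§2 above already proves the ED. 1∕2 bytes — the SAME conclusion for EVERY matrix `H` — because the dimension count needs no reductivity; so the ED. 3 socket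
is §2 with two binders discarded.  Both editions are therefore paid by name from this file, whichever the line re-ties to. -/

open scoped Matrix in
/-- **Socket #4 `sig_K2E1OccursEventuallySpherical`, ED. 3 bytes** (hermitian `ᵗH̄ = H`, `det H ≠ 0`; the organ abbreviation `Pl L = HeightOneSpectrum (𝓞 L⁺)`
spelled out): an occurring family of finite local classes of the unitary group `U(H)` is spherical for some compact open subgroup at all but finitely many
places.  Immediate from the hypothesis-free `OccursEventuallySpherical` (§2): the two extra binders are not used — Flath's count through the admissibility of
the global finite component holds for every `H`. [cite: FlathCorvallis1979, Thm. 3] [cite: BorelJacquet1979, §4.6] [cite: Rogawski1990, §13.8 p. 219] -/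
theorem OccursEventuallySphericalOfHermitian :
    ∀ (L : Type) [Field L] [NumberField L] [IsCMField L] (N : ℕ) (H : Matrix (Fin N) (Fin N) L),
      (H.map (cmConjRingHom L))ᵀ = H → H.det ≠ 0 →
      ∀ (μ : Measure (adelicGroupData (↥(maximalRealSubfield L)) L (IsCMField.complexConj L) N H).automorphicQuotient)
      [(adelicGroupData (↥(maximalRealSubfield L)) L (IsCMField.complexConj L) N H).IsAutomorphicMeasure μ]
      (π : ∀ u : HeightOneSpectrum (𝓞 ↥(maximalRealSubfield L)), IrrClass ((UnitaryGroup.cmDatum L N H).Local u)),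
      cmOccursInDiscreteSpectrum L N H μ π →
        ∀ᶠ u in Filter.cofinite, ∃ K : Subgroup ((UnitaryGroup.cmDatum L N H).Local u),
          IsOpen (K : Set ((UnitaryGroup.cmDatum L N H).Local u)) ∧ IsCompact (K : Set ((UnitaryGroup.cmDatum L N H).Local u)) ∧ (π u).IsSpherical K :=
  fun L _ _ _ N H _ _ μ _ π hπ => OccursEventuallySpherical L N H μ π hπ

end Summit.HodgeConjecture.HodgeConjecture.Cruxes.H413.K2E1OccursEventuallySpherical

end
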